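import Mathlib
import Literature.Combinatorics.Enumerative.SymplecticCharacterVSASM
import HarnessLib

/-!
# The symplectic bialternant of Ikhlef–Ponsaing: Weyl denominator and homogeneous value

Topic `Literature/Combinatorics/Enumerative`. Ikhlef–Ponsaing (J. Stat. Phys. 149 (2012),
arXiv:1202.5476) Def. 3.4 defines the symplectic character as a BIALTERNANT,
`χ_λ^{(L)}(u_1,…,u_L) = det[u_i^{μ_j} - u_i^{-μ_j}] / det[u_i^{δ_j} - u_i^{-δ_j}]`,
`δ_j = L - j + 1`, `μ_j = λ_j + δ_j`, `λ_j = ⌊(L-j)/2⌋`; with `k = L - j` the exponents are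
`δ = k + 1` and `μ = ipMu k` (`SymplecticCharacterVSASM.lean`). Prop. 4.7 of IP12 needs the
HOMOGENEOUS value `χ_L(1,…,1)`, where both alternants vanish; `SymplecticCharacterVSASM.lean`
takes this value to be Weyl's dimension product `ipSpDim L` on the authority of the classical
identification "character at the identity = Weyl dimension". This file proves that identification
in the form actually used (the principal specialisation `u_i = q^i`, `q → 1`):

* `spE n` — the polynomials with `u^{n+1} - u^{-(n+1)} = (u - u^{-1}) E_n(u + u^{-1})` (Chebyshev
  `S_n`), monic of degree `n` (`spE_monic_natDegree`, `spE_eval`);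
* `spAlt L e u = det[u_i^{e_k} - u_i^{-e_k}]` and **`spAlt_succ_eq`** — the WEYL DENOMINATOR formula
  of type `C_L`: `det[u_i^{k+1} - u_i^{-(k+1)}] = ∏_i (u_i - u_i^{-1}) ∏_{k<l} (x_l - x_k)`,
  `x = u + u^{-1}` (row factorisation + Vandermonde);
* `spAlt_principal` — at `u_i = q^{i+1}` every alternant is a Weyl denominator in the variables
  `q^{e_k}` (transpose), hence a product;
* `spChar L u := spAlt L ipMu u / spAlt L (·+1) u` — IP12's `χ_L(u)` as printed (Def. 3.4), and
  **`tendsto_spChar_principal`**: `χ_L(q, q², …, q^L) → ipSpDim L` as `q → 1`, i.e. the homogeneous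
  value of Def. 3.4's character IS the Weyl dimension product used in `ipSpDim_ratio_real`
  (Prop. 4.7): each factor `(q^{μ} - q^{-μ})/(q^{δ} - q^{-δ}) → μ/δ` and
  `(c(μ_l) - c(μ_k))/(c(δ_l) - c(δ_k)) → (μ_l² - μ_k²)/(δ_l² - δ_k²)`, `c(a) = q^a + q^{-a}`.

(The polynomiality of the bialternant ratio — Weyl's character formula proper — is not needed for
this and is not proved here.)

## References

* Y. Ikhlef, A. K. Ponsaing, J. Stat. Phys. 149 (2012) 10–36, arXiv:1202.5476, Def. 3.4,
  Prop. 4.7. [IkhlefPonsaing2012]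
* W. Fulton, J. Harris, Representation Theory, GTM 129, Springer 1991, §24.2 (Weyl character and
  dimension formulas for `Sp(2n)`). [FultonHarris1991]
-/

namespace Literature.Combinatorics.Enumerative

open Finset Matrix Polynomial Filter Topology

/-! ### The polynomials `E_n` with `u^{n+1} - u^{-(n+1)} = (u - u^{-1}) E_n(u + u^{-1})` -/

/-- `E_0 = 1`, `E_1 = X`, `E_{n+2} = X E_{n+1} - E_n` (the Chebyshev polynomials `S_n`, i.e.
`U_n(x/2)`; Dickson polynomials of the second kind). [folklore] -/
noncomputable def spE : ℕ → ℝ[X]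
  | 0 => 1
  | 1 => X
  | n + 2 => X * spE (n + 1) - spE n

/-- `E_0 = 1`. [folklore] -/
theorem spE_zero : spE 0 = 1 := rfl

/-- `E_1 = X`. [folklore] -/
theorem spE_one : spE 1 = X := rfl

/-- The three-term recurrence. [folklore] -/
theorem spE_add_two (n : ℕ) : spE (n + 2) = X * spE (n + 1) - spE n := rfl

/-- `E_n` is monic of degree `n`. [folklore] -/
theorem spE_monic_natDegree : ∀ n, (spE n).Monic ∧ (spE n).natDegree = n
  | 0 => ⟨monic_one, natDegree_one⟩
  | 1 => ⟨monic_X, natDegree_X⟩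
  | n + 2 => by
    obtain ⟨hm1, hd1⟩ := spE_monic_natDegree (n + 1)
    obtain ⟨hm0, hd0⟩ := spE_monic_natDegree n
    have hmX : (X * spE (n + 1)).Monic := monic_X.mul hm1
    have hdX : (X * spE (n + 1)).natDegree = n + 2 := by
      rw [monic_X.natDegree_mul hm1, natDegree_X, hd1]
      omega
    have hlt : (spE n).degree < (X * spE (n + 1)).degree := by
      rw [degree_eq_natDegree hm0.ne_zero, degree_eq_natDegree hmX.ne_zero, hd0, hdX]
      exact_mod_cast (by omega : n < n + 2)
    have hlt' : (spE n).natDegree < (X * spE (n + 1)).natDegree := by rw [hd0, hdX]; omega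
    rw [spE_add_two]
    exact ⟨hmX.sub_of_left hlt, by rw [natDegree_sub_eq_left_of_natDegree_lt hlt', hdX]⟩

/-- **The defining identity**: `(u - u^{-1}) E_n(u + u^{-1}) = u^{n+1} - u^{-(n+1)}` (`u ≠ 0`). [folklore] -/
theorem spE_eval {u : ℝ} (hu : u ≠ 0) :
    ∀ n, (u - u⁻¹) * (spE n).eval (u + u⁻¹) = u ^ (n + 1) - u⁻¹ ^ (n + 1)
  | 0 => by simp [spE_zero]
  | 1 => by simp only [spE_one, eval_X]; ring
  | n + 2 => by
    have h1 := spE_eval hu (n + 1)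
    have h0 := spE_eval hu n
    rw [spE_add_two, eval_sub, eval_mul, eval_X, mul_sub, h0, ← mul_assoc, mul_comm (u - u⁻¹),
      mul_assoc, h1]
    have e : u * u⁻¹ = 1 := mul_inv_cancel₀ hu
    linear_combination (u ^ (n + 1) - u⁻¹ ^ (n + 1)) * e

/-! ### The alternants and the Weyl denominator of type `C` -/

/-- **IP12's alternant** `a_e(u) = det[u_i^{e_k} - u_i^{-e_k}]_{i,k<L}` (Def. 3.4, columns indexed by
`k = L - j`). [cite: IkhlefPonsaing2012, Def. 3.4] -/
noncomputable def spAlt (L : ℕ) (e : ℕ → ℕ) (u : Fin L → ℝ) : ℝ :=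
  det (of fun i k : Fin L => u i ^ e k - (u i)⁻¹ ^ e k)

/-- **IP12's symplectic character as printed** (Def. 3.4, `λ_j = ⌊(L-j)/2⌋`): the bialternant
`χ_L(u) = det[u_i^{μ_k} - u_i^{-μ_k}] / det[u_i^{k+1} - u_i^{-(k+1)}]`, `μ_k = ipMu k`, as a real
function (meaningful where the Weyl denominator does not vanish). [cite: IkhlefPonsaing2012, Def. 3.4] -/
noncomputable def spChar (L : ℕ) (u : Fin L → ℝ) : ℝ :=
  spAlt L ipMu u / spAlt L (· + 1) u

/-- **Weyl's denominator formula for `Sp(2L)`**: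
`det[u_i^{k+1} - u_i^{-(k+1)}] = ∏_i (u_i - u_i^{-1}) · ∏_{k<l} ((u_l + u_l^{-1}) - (u_k + u_k^{-1}))`.
[cite: FultonHarris1991, §24.2] -/
theorem spAlt_succ_eq (L : ℕ) (u : Fin L → ℝ) (hu : ∀ i, u i ≠ 0) :
    spAlt L (· + 1) u =
      (∏ i, (u i - (u i)⁻¹)) * ∏ i : Fin L, ∏ j ∈ Ioi i, ((u j + (u j)⁻¹) - (u i + (u i)⁻¹)) := by
  unfold spAlt
  have h1 : (of fun i k : Fin L => u i ^ ((k : ℕ) + 1) - (u i)⁻¹ ^ ((k : ℕ) + 1)) =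
      of fun i k : Fin L => (u i - (u i)⁻¹) *
        (of fun i k : Fin L => (spE k).eval (u i + (u i)⁻¹)) i k := by
    ext i k
    simp only [of_apply]
    rw [spE_eval (hu i)]
  rw [h1, det_mul_column, ← det_vandermonde,
    det_eval_matrixOfPolynomials_eq_det_vandermonde (fun i => u i + (u i)⁻¹) (fun k : Fin L => spE k)
      (fun k => (spE_monic_natDegree k).2) (fun k => (spE_monic_natDegree k).1)]

/-- **Principal specialisation**: at `u_i = q^{i+1}` the alternant with exponents `e` is the Weyl
denominator in the variables `q^{e_k}` (the matrix is a transpose). [folklore] -/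
theorem spAlt_principal (L : ℕ) (e : ℕ → ℕ) (q : ℝ) :
    spAlt L e (fun i => q ^ ((i : ℕ) + 1)) = spAlt L (· + 1) (fun k => q ^ e k) := by
  unfold spAlt
  have : (of fun i k : Fin L => (q ^ ((i : ℕ) + 1)) ^ e k - (q ^ ((i : ℕ) + 1))⁻¹ ^ e k) =
      (of fun k i : Fin L => (q ^ e k) ^ ((i : ℕ) + 1) - (q ^ e k)⁻¹ ^ ((i : ℕ) + 1))ᵀ := by
    ext i k
    simp only [of_apply, transpose_apply, ← pow_mul, inv_pow]
    rw [mul_comm]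
  rw [this, det_transpose]

/-! ### The elementary factors and their values at `q = 1` -/

/-- The geometric sum `1 + q + ⋯ + q^{n-1}`. [folklore] -/
noncomputable def spGeom (n : ℕ) (q : ℝ) : ℝ := ∑ i ∈ range n, q ^ i

/-- `spGeom n 1 = n`. [folklore] -/
theorem spGeom_one (n : ℕ) : spGeom n 1 = n := by simp [spGeom]

/-- `spGeom n` is continuous. [folklore] -/
theorem continuous_spGeom (n : ℕ) : Continuous (spGeom n) := by
  unfold spGeom
  fun_prop

/-- `D_a(q) := q^{-a} (1 + q + ⋯ + q^{2a-1})`, so that `q^a - q^{-a} = (q - 1) D_a(q)`. [folklore] -/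
noncomputable def spDfac (a : ℕ) (q : ℝ) : ℝ := q⁻¹ ^ a * spGeom (2 * a) q

/-- `H_a(q) := q^{-a} (1 + ⋯ + q^{a-1})²`, so that `q^a + q^{-a} - 2 = (q - 1)² H_a(q)`. [folklore] -/
noncomputable def spHfac (a : ℕ) (q : ℝ) : ℝ := q⁻¹ ^ a * spGeom a q ^ 2

/-- `q^a - q^{-a} = (q - 1) D_a(q)`. [folklore] -/
theorem pow_sub_inv_pow_eq_spDfac {q : ℝ} (hq : q ≠ 0) (a : ℕ) :
    q ^ a - q⁻¹ ^ a = (q - 1) * spDfac a q := by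
  unfold spDfac spGeom
  have h := geom_sum_mul q (2 * a)
  have e : q⁻¹ ^ a * q ^ a = 1 := by rw [← mul_pow, inv_mul_cancel₀ hq, one_pow]
  calc q ^ a - q⁻¹ ^ a = q⁻¹ ^ a * (q ^ (2 * a) - 1) := by linear_combination (-(q ^ a)) * e
    _ = (q - 1) * (q⁻¹ ^ a * ∑ i ∈ range (2 * a), q ^ i) := by rw [← h]; ring

/-- `(q^a + q^{-a}) - (q^b + q^{-b}) = (q - 1)² (H_a(q) - H_b(q))`. [folklore] -/
theorem addInv_sub_addInv_eq_spHfac {q : ℝ} (hq : q ≠ 0) (a b : ℕ) :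
    (q ^ a + q⁻¹ ^ a) - (q ^ b + q⁻¹ ^ b) = (q - 1) ^ 2 * (spHfac a q - spHfac b q) := by
  have key : ∀ n : ℕ, q ^ n + q⁻¹ ^ n - 2 = (q - 1) ^ 2 * spHfac n q := by
    intro n
    unfold spHfac spGeom
    have h := geom_sum_mul q n
    have e : q⁻¹ ^ n * q ^ n = 1 := by rw [← mul_pow, inv_mul_cancel₀ hq, one_pow]
    calc q ^ n + q⁻¹ ^ n - 2 = q⁻¹ ^ n * (q ^ n - 1) ^ 2 := by linear_combination (2 - q ^ n) * e
      _ = (q - 1) ^ 2 * (q⁻¹ ^ n * (∑ i ∈ range n, q ^ i) ^ 2) := by rw [← h]; ring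
  linear_combination key a - key b

/-- `D_a` is continuous at `1` with value `2a`. [folklore] -/
theorem continuousAt_spDfac (a : ℕ) : ContinuousAt (spDfac a) 1 ∧ spDfac a 1 = 2 * a := by
  refine ⟨?_, by simp [spDfac, spGeom_one]⟩
  unfold spDfac
  exact ((continuousAt_inv₀ one_ne_zero).pow a).mul (continuous_spGeom _).continuousAt

/-- `H_a` is continuous at `1` with value `a²`. [folklore] -/
theorem continuousAt_spHfac (a : ℕ) : ContinuousAt (spHfac a) 1 ∧ spHfac a 1 = (a : ℝ) ^ 2 := by
  refine ⟨?_, by simp [spHfac, spGeom_one]⟩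
  unfold spHfac
  exact ((continuousAt_inv₀ one_ne_zero).pow a).mul ((continuous_spGeom _).continuousAt.pow 2)

/-! ### The homogeneous value of IP12's character: principal specialisation `q → 1` -/

/-- The regularised principal specialisation: the ratio of the factorised alternants with the
powers of `q - 1` cancelled. [folklore] -/
noncomputable def spCharReg (L : ℕ) (q : ℝ) : ℝ :=
  (∏ k : Fin L, spDfac (ipMu k) q / spDfac ((k : ℕ) + 1) q) *
    ∏ k : Fin L, ∏ l ∈ Ioi k,
      (spHfac (ipMu l) q - spHfac (ipMu k) q) / (spHfac ((l : ℕ) + 1) q - spHfac ((k : ℕ) + 1) q)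

/-- For `q > 0`, `q ≠ 1`, IP12's character at `(q, q², …, q^L)` is the regularised product. [folklore] -/
theorem spChar_principal_eq (L : ℕ) {q : ℝ} (hq : 0 < q) (hq1 : q ≠ 1) :
    spChar L (fun i => q ^ ((i : ℕ) + 1)) = spCharReg L q := by
  have hq0 : q ≠ 0 := hq.ne'
  have hq1' : q - 1 ≠ 0 := sub_ne_zero.2 hq1
  have hpow : ∀ n : ℕ, q ^ n ≠ 0 := fun n => pow_ne_zero n hq0
  unfold spChar spCharReg
  rw [spAlt_principal, spAlt_principal, spAlt_succ_eq _ _ fun k => hpow _,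
    spAlt_succ_eq _ _ fun k => hpow _, mul_div_mul_comm, ← prod_div_distrib, ← prod_div_distrib]
  congr 1
  · refine prod_congr rfl fun k _ => ?_
    simp only [← inv_pow]
    rw [pow_sub_inv_pow_eq_spDfac hq0, pow_sub_inv_pow_eq_spDfac hq0, mul_div_mul_left _ _ hq1']
  · refine prod_congr rfl fun k _ => ?_
    rw [← prod_div_distrib]
    refine prod_congr rfl fun l _ => ?_
    simp only [← inv_pow]
    rw [addInv_sub_addInv_eq_spHfac hq0, addInv_sub_addInv_eq_spHfac hq0,
      mul_div_mul_left _ _ (pow_ne_zero 2 hq1')]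

/-- The regularised product is continuous at `q = 1`, with value Weyl's dimension product. [folklore] -/
theorem tendsto_spCharReg (L : ℕ) :
    Tendsto (spCharReg L) (𝓝 1)
      (𝓝 ((∏ k : Fin L, (ipMu k : ℝ) / ((k : ℕ) + 1)) *
        ∏ k : Fin L, ∏ l ∈ Ioi k,
          (((ipMu l : ℝ)) ^ 2 - (ipMu k : ℝ) ^ 2) / ((((l : ℕ) : ℝ) + 1) ^ 2 - (((k : ℕ) : ℝ) + 1) ^ 2))) := by
  unfold spCharReg
  refine Tendsto.mul (tendsto_finsetProd _ fun k _ => ?_) (tendsto_finsetProd _ fun k _ =>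
    tendsto_finsetProd _ fun l hl => ?_)
  · have hD := continuousAt_spDfac (ipMu k)
    have hD' := continuousAt_spDfac ((k : ℕ) + 1)
    have h1 : Tendsto (spDfac (ipMu k)) (𝓝 1) (𝓝 (2 * (ipMu k : ℝ))) := hD.2 ▸ hD.1.tendsto
    have h2 : Tendsto (spDfac ((k : ℕ) + 1)) (𝓝 1) (𝓝 (2 * (((k : ℕ) + 1 : ℕ) : ℝ))) := hD'.2 ▸ hD'.1.tendsto
    have hne : (2 * (((k : ℕ) + 1 : ℕ) : ℝ)) ≠ 0 := by positivity
    have key : (ipMu k : ℝ) / ((k : ℕ) + 1) = 2 * (ipMu k : ℝ) / (2 * (((k : ℕ) + 1 : ℕ) : ℝ)) := by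
      push_cast
      rw [mul_div_mul_left _ _ (two_ne_zero' ℝ)]
    rw [key]
    exact h1.div h2 hne
  · have hkl : k < l := mem_Ioi.1 hl
    have hl' : (k : ℕ) < (l : ℕ) := Fin.lt_def.1 hkl
    have hA := continuousAt_spHfac (ipMu l)
    have hB := continuousAt_spHfac (ipMu k)
    have hC := continuousAt_spHfac ((l : ℕ) + 1)
    have hD := continuousAt_spHfac ((k : ℕ) + 1)
    have h1 : Tendsto (fun q => spHfac (ipMu l) q - spHfac (ipMu k) q) (𝓝 1)
        (𝓝 ((ipMu l : ℝ) ^ 2 - (ipMu k : ℝ) ^ 2)) := by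
      rw [← hA.2, ← hB.2]; exact hA.1.tendsto.sub hB.1.tendsto
    have h2 : Tendsto (fun q => spHfac ((l : ℕ) + 1) q - spHfac ((k : ℕ) + 1) q) (𝓝 1)
        (𝓝 (((((l : ℕ) + 1 : ℕ) : ℝ)) ^ 2 - ((((k : ℕ) + 1 : ℕ) : ℝ)) ^ 2)) := by
      rw [← hC.2, ← hD.2]; exact hC.1.tendsto.sub hD.1.tendsto
    have hne : ((((l : ℕ) + 1 : ℕ) : ℝ)) ^ 2 - ((((k : ℕ) + 1 : ℕ) : ℝ)) ^ 2 ≠ 0 := by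
      have : (((k : ℕ) + 1 : ℕ) : ℝ) < (((l : ℕ) + 1 : ℕ) : ℝ) := by exact_mod_cast Nat.succ_lt_succ hl'
      have h0 : (0 : ℝ) ≤ (((k : ℕ) + 1 : ℕ) : ℝ) := by positivity
      nlinarith
    have key : (((ipMu l : ℝ)) ^ 2 - (ipMu k : ℝ) ^ 2) / ((((l : ℕ) : ℝ) + 1) ^ 2 - (((k : ℕ) : ℝ) + 1) ^ 2) =
        ((ipMu l : ℝ) ^ 2 - (ipMu k : ℝ) ^ 2) /
          (((((l : ℕ) + 1 : ℕ) : ℝ)) ^ 2 - ((((k : ℕ) + 1 : ℕ) : ℝ)) ^ 2) := by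
      push_cast
      ring
    rw [key]
    exact h1.div h2 hne

/-- Weyl's dimension product, in the indexing of the determinant formulas, is `ipSpDim L`. [folklore] -/
theorem ipSpDim_cast_eq_prod (L : ℕ) :
    ((ipSpDim L : ℚ) : ℝ) =
      (∏ k : Fin L, (ipMu k : ℝ) / ((k : ℕ) + 1)) *
        ∏ k : Fin L, ∏ l ∈ Ioi k,
          (((ipMu l : ℝ)) ^ 2 - (ipMu k : ℝ) ^ 2) / ((((l : ℕ) : ℝ) + 1) ^ 2 - (((k : ℕ) : ℝ) + 1) ^ 2) := by
  -- reorder the double product as `∏_l ∏_{k<l}`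
  have hcomm : (∏ k : Fin L, ∏ l ∈ Ioi k,
      (((ipMu l : ℝ)) ^ 2 - (ipMu k : ℝ) ^ 2) / ((((l : ℕ) : ℝ) + 1) ^ 2 - (((k : ℕ) : ℝ) + 1) ^ 2)) =
      ∏ l : Fin L, ∏ k ∈ Iio l,
        (((ipMu l : ℝ)) ^ 2 - (ipMu k : ℝ) ^ 2) / ((((l : ℕ) : ℝ) + 1) ^ 2 - (((k : ℕ) : ℝ) + 1) ^ 2) := by
    refine prod_comm' fun k l => ?_
    simp only [mem_univ, true_and, and_true, mem_Ioi, mem_Iio]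
  rw [hcomm, ← prod_mul_distrib]
  -- pass to `range`
  have hIio : ∀ l : Fin L, (∏ k ∈ Iio l,
      (((ipMu l : ℝ)) ^ 2 - (ipMu k : ℝ) ^ 2) / ((((l : ℕ) : ℝ) + 1) ^ 2 - (((k : ℕ) : ℝ) + 1) ^ 2)) =
      ∏ k ∈ range l,
        (((ipMu l : ℝ)) ^ 2 - (ipMu k : ℝ) ^ 2) / ((((l : ℕ) : ℝ) + 1) ^ 2 - ((k : ℝ) + 1) ^ 2) := by
    intro l
    rw [← Nat.Iio_eq_range, ← Fin.map_valEmbedding_Iio, prod_map]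
    rfl
  simp_rw [hIio]
  rw [Fin.prod_univ_eq_prod_range (fun n => (ipMu n : ℝ) / ((n : ℝ) + 1) *
      ∏ k ∈ range n, (((ipMu n : ℝ)) ^ 2 - (ipMu k : ℝ) ^ 2) / (((n : ℝ) + 1) ^ 2 - ((k : ℝ) + 1) ^ 2)) L]
  simp only [ipSpDim, ipSpStep, Rat.cast_prod, Rat.cast_mul, Rat.cast_div, Rat.cast_natCast,
    Rat.cast_pow, Rat.cast_sub, Rat.cast_add, Rat.cast_one]

/-- **The homogeneous value of IP12's symplectic character is Weyl's dimension product**: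
`χ_L(q, q², …, q^L) → ipSpDim L` as `q → 1` (`q ≠ 1`), where `χ_L` is the bialternant of
IP12 Def. 3.4 and `ipSpDim L = ∏_l μ_l/(l+1) ∏_{k<l} (μ_l² - μ_k²)/((l+1)² - (k+1)²)` is the value
used in Prop. 4.7 (`SymplecticCharacterVSASM.ipSpDim_ratio_real`). [cite: IkhlefPonsaing2012, Def. 3.4, Prop. 4.7; FultonHarris1991, §24.2] -/
theorem tendsto_spChar_principal (L : ℕ) :
    Tendsto (fun q : ℝ => spChar L (fun i : Fin L => q ^ ((i : ℕ) + 1))) (𝓝[≠] 1)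
      (𝓝 ((ipSpDim L : ℚ) : ℝ)) := by
  rw [ipSpDim_cast_eq_prod]
  refine Tendsto.congr' ?_ (tendsto_nhdsWithin_of_tendsto_nhds (tendsto_spCharReg L))
  have hpos : ∀ᶠ q : ℝ in 𝓝[≠] 1, 0 < q :=
    mem_nhdsWithin_of_mem_nhds (lt_mem_nhds (by norm_num : (0 : ℝ) < 1))
  have hne : ∀ᶠ q : ℝ in 𝓝[≠] 1, q ≠ 1 := self_mem_nhdsWithin
  filter_upwards [hpos, hne] with q hq hq1
  exact (spChar_principal_eq L hq hq1).symm

end Literature.Combinatorics.Enumerative
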